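import Summits.ResolutionOfSingularities.ResolutionOfSingularities.Theorems.HilbertSamuelEliminationSigmaMaxModificationsCorridor3CPFrameCurveGermAlgebra
import Summits.ResolutionOfSingularities.ResolutionOfSingularities.Theorems.HilbertSamuelEliminationSigmaMaxModificationsCorridor3WLadderAlgIsolatedTransfer
import Literature.AlgebraicGeometry.Resolution.FlatLocalRegularAscent
import Literature.AlgebraicGeometry.Resolution.RegularLocalRingsProofs
import Literature.AlgebraicGeometry.Resolution.CompleteLocalDomainNormalization
import HarnessLib

/-!
# [OURS · L1 W4.2] THE CURVE CENTRE BECOMES A DVR-QUOTIENT PRIME IN THE FRAME — the glue between the `IsCPFrame` clauses (flat, local,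
# `𝔪_A · B = 𝔪_B`) and `…Corridor3CPFrameCurveGermAlgebra` (p525272): W4.2 D18 (ii), algebraic part, END TO END minus minimality
# (cell res-hironaka, LADDER-RESOLUTION rung L; slot W4.2, crux chain w42 `SigmaMaxModificationsCorridor3` stmt-ResolutionOfSingularities-19249;
# `--supports stmt-ResolutionOfSingularities-19249 --as helper`; res-L1-w42-plan-1 RULING v3.14-12a (BR-11) / (DF) D18 (ii) SPLIT;
# hand res-D-brk-3 (gen 5), (Q1-b) TAKING-UNLESS-OBJECTED 11:14:16Z; D18 holder res-D-pv-050 keeps (P2b), (Q2) minimality, hVP)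

PURE COMMUTATIVE ALGEBRA, 0 `def`s, every declaration PROVED; OURS bookkeeping; NOT a statement of Hironaka's manuscript [Hironaka2017] nor of
[CossartJannsenSaito2020]/[CossartPiltant2019]. AI-written, weaker than expert review.

* `isRegularLocalRing_quotient_map_of_flat` — for a FLAT LOCAL homomorphism `A → B` of Noetherian local rings with `𝔪_A B = 𝔪_B` (the three
  φ-clauses of res-type-067's `IsCPFrame`, p515936) and a proper ideal `q ⊂ A` with `A/q` REGULAR: `B/qB` is regular local of the same
  dimension (assembly of the tree's `IsRegularLocalRing.of_flat_of_map_maximalIdeal_eq`, Matsumura 23.7 (ii) with trivial closed fibre,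
  `Resolution/FlatLocalRegularAscent`, and `IdeasL1C4.ringKrullDim_quotient_map_eq_of_flat`, Matsumura 15.1, `…WLadderAlgIsolatedTransfer`).
* `exists_isDiscreteValuationRing_quotient_map_of_flat` — in dimension `1`: `B/qB` is a DVR (tree bridge
  `isDiscreteValuationRing_of_isRegularLocalRing_of_ringKrullDim_eq_one`; domain by `isDomain_of_isRegularLocalRing`).
* **`exists_isRsopPart_map_eq_of_flat_frame`** — THE ALGEBRA OF D18 (ii) END TO END (minus minimality): `R` regular local of dimension
  `n + 1`, `h ∈ R[X]` monic of degree `m ≥ 1` with `coeff_i h ∈ 𝔪_R^{m−i}` (`i < m`), `R[X]/(h)` local, `φ : A → R[X]/(h)` local, flat, with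
  `φ(𝔪_A)·(R[X]/(h)) = 𝔪` (`IsCPFrame`'s clauses), and `q ⊂ A` proper with `A/q` regular of dimension `1` (the stalk ideal of a regular
  CURVE centre through the marked point): then `q·(R[X]/(h)) = (X − θ, v₁, …, v_n)·(R[X]/(h))` with `θ ∈ 𝔪_R` and `v` PART OF A REGULAR
  SYSTEM OF PARAMETERS of `R` — the centre clause of `IsCPFrameAlong` up to the translation `X ↦ X − θ` (res-D-pv-050 `isCPFrame_translate`,
  p521363) and the change of r.s.p. `u ↦ (u₀', v)`; what remains for `exists_isCPFrameAlong_of_isHypStage` is the MINIMALITY of the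
  translated polyhedron ((Q2), Hironaka's vertex preparation hVP) — res-D-pv-050's.

References: Matsumura, *Commutative Ring Theory*, Thm. 15.1, 23.7, 14.2, 11.2 [Matsumura1987]; tree p525272 (`…CPFrameCurveGermAlgebra`),
`Resolution/FlatLocalRegularAscent`, `…WLadderAlgIsolatedTransfer` (p515xxx), `Resolution/RegularLocalRingsProofs`,
`Resolution/CompleteLocalDomainNormalization`; HOME STATUS res-L1-w42-plan-1 10:24:54Z (BR-11), 10:52:00Z (DF); res-D-pv-050 11:11:53Z (P2a)/(P2b).
-/

noncomputable section

set_option linter.dupNamespace false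

open IsLocalRing Polynomial
open Literature.AlgebraicGeometry.Resolution
open Summit.ResolutionOfSingularities.ResolutionOfSingularities.Cruxes.SigmaMaxModifications.IdeasL1C4

universe u

namespace Summit.ResolutionOfSingularities.ResolutionOfSingularities.Theorems.SigmaMaxModificationsCorridor3.Helpers

variable {O B : Type u} [CommRing O] [CommRing B] [IsLocalRing O] [IsNoetherianRing O] [IsLocalRing B] [IsNoetherianRing B]
  [Algebra O B] [IsLocalHom (algebraMap O B)] [Module.Flat O B]

/-- [OURS · L1 W4.2] **Regular quotients ASCEND along a flat local homomorphism with `𝔪_A B = 𝔪_B`, with the same dimension**: `A → B`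
flat local (Noetherian local rings) with `𝔪_A B = 𝔪_B`, `q ⊂ A` proper with `A/q` regular ⇒ `B/qB` regular and `dim B/qB = dim A/q` — `A/q → B/qB` is
again flat local with trivial closed fibre (Matsumura 23.7 (ii) / 15.1, tree lemmas). [cite: Matsumura1987, Thm. 23.7] -/
theorem isRegularLocalRing_quotient_map_of_flat (hm : (maximalIdeal O).map (algebraMap O B) = maximalIdeal B)
    (q : Ideal O) (hq : q ≠ ⊤) [IsRegularLocalRing (O ⧸ q)] :
    IsRegularLocalRing (B ⧸ q.map (algebraMap O B)) ∧
      ringKrullDim (B ⧸ q.map (algebraMap O B)) = ringKrullDim (O ⧸ q) := by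
  have hqm : q ≤ maximalIdeal O := IsLocalRing.le_maximalIdeal hq
  have hqB : q.map (algebraMap O B) ≠ ⊤ := by
    intro htop
    apply (maximalIdeal.isMaximal B).ne_top
    rw [← hm]
    exact top_le_iff.mp (htop ▸ Ideal.map_mono hqm)
  haveI : Nontrivial (B ⧸ q.map (algebraMap O B)) := Ideal.Quotient.nontrivial_iff.mpr hqB
  haveI : IsLocalRing (B ⧸ q.map (algebraMap O B)) :=
    .of_surjective' (Ideal.Quotient.mk _) Ideal.Quotient.mk_surjective
  haveI : Module.Flat (O ⧸ q) (B ⧸ q.map (algebraMap O B)) :=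
    Module.Flat.of_linearEquiv (Algebra.TensorProduct.quotIdealMapEquivQuotTensor B q).toLinearEquiv
  haveI hmk : IsLocalHom (Ideal.Quotient.mk (q.map (algebraMap O B))) :=
    IsLocalHom.of_surjective _ Ideal.Quotient.mk_surjective
  haveI : IsLocalHom (algebraMap (O ⧸ q) (B ⧸ q.map (algebraMap O B))) := by
    refine ⟨fun x hx => ?_⟩
    obtain ⟨x, rfl⟩ := Ideal.Quotient.mk_surjective x
    rw [Ideal.Quotient.algebraMap_quotient_map_quotient] at hx
    have h2 : IsUnit (algebraMap O B x) := IsLocalHom.map_nonunit _ hx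
    exact (IsLocalHom.map_nonunit _ h2).map _
  have hfib : (maximalIdeal (O ⧸ q)).map (algebraMap (O ⧸ q) (B ⧸ q.map (algebraMap O B))) =
      maximalIdeal (B ⧸ q.map (algebraMap O B)) := by
    rw [← map_maximalIdeal_of_surjective (Ideal.Quotient.mk q) Ideal.Quotient.mk_surjective, Ideal.map_map,
      ← map_maximalIdeal_of_surjective (Ideal.Quotient.mk (q.map (algebraMap O B))) Ideal.Quotient.mk_surjective,
      ← hm, Ideal.map_map]
    congr 1
  exact ⟨IsRegularLocalRing.of_flat_of_map_maximalIdeal_eq (O ⧸ q) (B ⧸ q.map (algebraMap O B)) hfib,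
    ringKrullDim_quotient_map_eq_of_flat hm q hq⟩

/-- [OURS · L1 W4.2] **… in dimension one: `B/qB` is a DISCRETE VALUATION RING** (a regular curve germ stays a regular curve germ through a
flat local homomorphism with trivial closed fibre). [cite: Matsumura1987, Thm. 23.7, Thm. 11.2] -/
theorem exists_isDiscreteValuationRing_quotient_map_of_flat (hm : (maximalIdeal O).map (algebraMap O B) = maximalIdeal B)
    (q : Ideal O) (hq : q ≠ ⊤) [IsRegularLocalRing (O ⧸ q)] (hq1 : ringKrullDim (O ⧸ q) = 1) :
    ∃ _ : IsDomain (B ⧸ q.map (algebraMap O B)), IsDiscreteValuationRing (B ⧸ q.map (algebraMap O B)) := by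
  obtain ⟨hreg, hdim⟩ := isRegularLocalRing_quotient_map_of_flat hm q hq
  haveI : IsDomain (B ⧸ q.map (algebraMap O B)) := isDomain_of_isRegularLocalRing _
  exact ⟨inferInstance, isDiscreteValuationRing_of_isRegularLocalRing_of_ringKrullDim_eq_one _ (hdim.trans hq1)⟩


/-- [OURS · L1 W4.2] **THE ALGEBRA OF D18 (ii), END TO END (minus minimality): the image of a regular CURVE centre in a CP frame is
`(X − θ, v₁, …, v_n)`.** `R` regular local of dimension `n + 1`; `h ∈ R[X]` monic of degree `m ≥ 1` with `coeff_i h ∈ 𝔪_R^{m−i}`; `R[X]/(h)`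
local; `φ : A → R[X]/(h)` local, flat, `φ(𝔪_A)·(R[X]/(h)) = 𝔪` (the clauses of res-type-067's `IsCPFrame`); `q ⊂ A` proper with `A/q`
regular of dimension `1`. Then `q·(R[X]/(h))` is the image of `(X − θ, v₁, …, v_n) ⊆ R[X]` with `θ ∈ 𝔪_R` and `v` part of a regular system
of parameters of `R` (`exists_isDiscreteValuationRing_quotient_map_of_flat` + p525272 `exists_isRsopPart_map_span_eq_of_frame`).
[cite: Matsumura1987, Thm. 14.2, Thm. 23.7] -/
theorem exists_isRsopPart_map_eq_of_flat_frame {R : Type u} [CommRing R] [IsRegularLocalRing R] {n : ℕ}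
    (hd : ringKrullDim R = (n + 1 : ℕ)) {h : R[X]} (hmo : h.Monic) (hm : 0 < h.natDegree)
    (hco : ∀ i < h.natDegree, h.coeff i ∈ maximalIdeal R ^ (h.natDegree - i))
    [IsLocalRing (R[X] ⧸ Ideal.span {h})]
    {A : Type u} [CommRing A] [IsLocalRing A] [IsNoetherianRing A]
    (φ : A →+* R[X] ⧸ Ideal.span {h}) (hloc : IsLocalHom φ) (hflat : φ.Flat)
    (hmA : (maximalIdeal A).map φ = maximalIdeal (R[X] ⧸ Ideal.span {h}))
    (q : Ideal A) (hq : q ≠ ⊤) [IsRegularLocalRing (A ⧸ q)] (hq1 : ringKrullDim (A ⧸ q) = 1) :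
    ∃ θ ∈ maximalIdeal R, ∃ v : Fin n → R, IsRsopPart v ∧
      q.map φ = (Ideal.span (insert (X - C θ) (Set.range fun i => C (v i)))).map (Ideal.Quotient.mk (Ideal.span {h})) := by
  letI : Algebra A (R[X] ⧸ Ideal.span {h}) := φ.toAlgebra
  haveI : IsLocalHom (algebraMap A (R[X] ⧸ Ideal.span {h})) := hloc
  haveI : Module.Flat A (R[X] ⧸ Ideal.span {h}) := hflat
  obtain ⟨_, hdvr⟩ := exists_isDiscreteValuationRing_quotient_map_of_flat (O := A) (B := R[X] ⧸ Ideal.span {h}) hmA q hq hq1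
  haveI : (q.map φ).IsPrime := (Ideal.Quotient.isDomain_iff_prime _).mp inferInstance
  haveI : IsDiscreteValuationRing ((R[X] ⧸ Ideal.span {h}) ⧸ q.map φ) := hdvr
  exact exists_isRsopPart_map_span_eq_of_frame hd hmo hm hco

end Summit.ResolutionOfSingularities.ResolutionOfSingularities.Theorems.SigmaMaxModificationsCorridor3.Helpers

end
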